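import Mathlib

/-!
# Block-additivity of discrepancy (component reduction, analytic half) — line «sfm-bl»

FRONTIER F-N1c; nothing here bears on P vs NP.

PROOF-SFM-BL Lemma 3 says: a discrepancy bound `|uᵀMv| ≤ γ√(|u||v|)` assumed only for CONNECTED pairs of
a bipartite (multi)graph extends to all pairs of disjoint-side 0/1 vectors, by splitting `(u, v)` along the
connected components of the support and Cauchy–Schwarz.  This file proves the analytic half in abstract
form (`disc_of_blockwise`): if the rows and columns carry labels `p, q` into a finite type, `M` vanishes off
the diagonal blocks `{p = c} × {q = c}`, and the bound holds for pairs supported inside each block, then it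
holds for all pairs.  (The user instantiates the labels with the connected components of the support graph
restricted to `supp u ⊔ supp v`.)
-/

namespace Summit.PneNP.PneNP.Theorems.SfmBl

open Matrix Finset BigOperators

/-- Cauchy–Schwarz with square roots: `Σ_c √(x_c·y_c) ≤ √(Σ_c x_c · Σ_c y_c)` for non-negative families. -/
theorem sum_sqrt_mul_le {κ : Type*} (s : Finset κ) (x y : κ → ℝ) (hx : ∀ c, 0 ≤ x c)
    (hy : ∀ c, 0 ≤ y c) :
    ∑ c ∈ s, Real.sqrt (x c * y c) ≤ Real.sqrt ((∑ c ∈ s, x c) * (∑ c ∈ s, y c)) := by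
  have hcs := Finset.sum_mul_sq_le_sq_mul_sq s (fun c => Real.sqrt (x c)) (fun c => Real.sqrt (y c))
  have e1 : ∀ c, Real.sqrt (x c) ^ 2 = x c := fun c => Real.sq_sqrt (hx c)
  have e2 : ∀ c, Real.sqrt (y c) ^ 2 = y c := fun c => Real.sq_sqrt (hy c)
  simp only [e1, e2] at hcs
  have e3 : ∀ c, Real.sqrt (x c * y c) = Real.sqrt (x c) * Real.sqrt (y c) :=
    fun c => Real.sqrt_mul (hx c) (y c)
  simp only [e3]
  exact le_trans (le_abs_self _) (Real.abs_le_sqrt hcs)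

/-- BLOCK-ADDITIVITY OF DISCREPANCY.  Rows labelled by `p`, columns by `q`; `M` vanishes off the diagonal
blocks; the discrepancy bound holds for 0/1 pairs supported inside a single block `c`; then it holds for all
0/1 pairs. -/
theorem disc_of_blockwise {α β κ : Type*} [Fintype α] [Fintype β] [Fintype κ] [DecidableEq κ]
    (M : Matrix α β ℝ) (p : α → κ) (q : β → κ)
    (hM : ∀ i j, p i ≠ q j → M i j = 0) {γ : ℝ} (hγ : 0 ≤ γ)
    (h : ∀ c : κ, ∀ u : α → ℝ, ∀ v : β → ℝ,
      (∀ i, u i = 0 ∨ u i = 1) → (∀ j, v j = 0 ∨ v j = 1) →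
      (∀ i, p i ≠ c → u i = 0) → (∀ j, q j ≠ c → v j = 0) →
      |u ⬝ᵥ (M *ᵥ v)| ≤ γ * Real.sqrt ((∑ i, u i) * (∑ j, v j)))
    (u : α → ℝ) (v : β → ℝ) (hu : ∀ i, u i = 0 ∨ u i = 1) (hv : ∀ j, v j = 0 ∨ v j = 1) :
    |u ⬝ᵥ (M *ᵥ v)| ≤ γ * Real.sqrt ((∑ i, u i) * (∑ j, v j)) := by
  classical
  -- the pieces of `u` and `v` in block `c`
  let uc : κ → α → ℝ := fun c i => if p i = c then u i else 0
  let vc : κ → β → ℝ := fun c j => if q j = c then v j else 0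
  have huc01 : ∀ c i, uc c i = 0 ∨ uc c i = 1 := by
    intro c i; by_cases hp : p i = c
    · simpa [uc, hp] using hu i
    · simp [uc, hp]
  have hvc01 : ∀ c j, vc c j = 0 ∨ vc c j = 1 := by
    intro c j; by_cases hq : q j = c
    · simpa [vc, hq] using hv j
    · simp [vc, hq]
  have hucs : ∀ c i, p i ≠ c → uc c i = 0 := by intro c i hp; simp [uc, hp]
  have hvcs : ∀ c j, q j ≠ c → vc c j = 0 := by intro c j hq; simp [vc, hq]
  -- (1) the bilinear form splits along the blocks
  have hexp : u ⬝ᵥ (M *ᵥ v) = ∑ c, (uc c) ⬝ᵥ (M *ᵥ (vc c)) := by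
    have key : ∀ i j, u i * (M i j * v j) = ∑ c, uc c i * (M i j * vc c j) := by
      intro i j
      have : ∀ c, uc c i * (M i j * vc c j)
          = if p i = c then u i * (M i j * (if q j = c then v j else 0)) else 0 := by
        intro c; by_cases hp : p i = c <;> simp [uc, vc, hp]
      simp only [this, Finset.sum_ite_eq, Finset.mem_univ, if_true]
      by_cases hpq : q j = p i
      · simp [hpq]
      · have hz : M i j = 0 := hM i j (fun h' => hpq h'.symm)
        simp [hz]
    calc u ⬝ᵥ (M *ᵥ v) = ∑ i, ∑ j, u i * (M i j * v j) := by
          simp only [dotProduct, Matrix.mulVec, Finset.mul_sum]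
      _ = ∑ i, ∑ j, ∑ c, uc c i * (M i j * vc c j) :=
          Finset.sum_congr rfl fun i _ => Finset.sum_congr rfl fun j _ => key i j
      _ = ∑ i, ∑ c, ∑ j, uc c i * (M i j * vc c j) :=
          Finset.sum_congr rfl fun i _ => Finset.sum_comm
      _ = ∑ c, ∑ i, ∑ j, uc c i * (M i j * vc c j) := Finset.sum_comm
      _ = ∑ c, (uc c) ⬝ᵥ (M *ᵥ (vc c)) := by
          simp only [dotProduct, Matrix.mulVec, Finset.mul_sum]
  -- (2) block sizes add up
  have husum : ∑ c, ∑ i, uc c i = ∑ i, u i := by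
    rw [Finset.sum_comm]
    refine Finset.sum_congr rfl fun i _ => ?_
    have : ∀ c, uc c i = if p i = c then u i else 0 := fun c => rfl
    simp only [this, Finset.sum_ite_eq, Finset.mem_univ, if_true]
  have hvsum : ∑ c, ∑ j, vc c j = ∑ j, v j := by
    rw [Finset.sum_comm]
    refine Finset.sum_congr rfl fun j _ => ?_
    have : ∀ c, vc c j = if q j = c then v j else 0 := fun c => rfl
    simp only [this, Finset.sum_ite_eq, Finset.mem_univ, if_true]
  -- (3) nonnegativity of block sizes
  have hx : ∀ c, 0 ≤ ∑ i, uc c i := by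
    intro c; refine Finset.sum_nonneg fun i _ => ?_
    rcases huc01 c i with h0 | h1
    · rw [h0]
    · rw [h1]; exact zero_le_one
  have hy : ∀ c, 0 ≤ ∑ j, vc c j := by
    intro c; refine Finset.sum_nonneg fun j _ => ?_
    rcases hvc01 c j with h0 | h1
    · rw [h0]
    · rw [h1]; exact zero_le_one
  -- (4) assemble
  calc |u ⬝ᵥ (M *ᵥ v)| = |∑ c, (uc c) ⬝ᵥ (M *ᵥ (vc c))| := by rw [hexp]
    _ ≤ ∑ c, |(uc c) ⬝ᵥ (M *ᵥ (vc c))| := Finset.abs_sum_le_sum_abs _ _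
    _ ≤ ∑ c, γ * Real.sqrt ((∑ i, uc c i) * (∑ j, vc c j)) :=
        Finset.sum_le_sum fun c _ => h c (uc c) (vc c) (huc01 c) (hvc01 c) (hucs c) (hvcs c)
    _ = γ * ∑ c, Real.sqrt ((∑ i, uc c i) * (∑ j, vc c j)) := by rw [Finset.mul_sum]
    _ ≤ γ * Real.sqrt ((∑ c, ∑ i, uc c i) * (∑ c, ∑ j, vc c j)) :=
        mul_le_mul_of_nonneg_left (sum_sqrt_mul_le _ _ _ hx hy) hγ
    _ = γ * Real.sqrt ((∑ i, u i) * (∑ j, v j)) := by rw [husum, hvsum]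

end Summit.PneNP.PneNP.Theorems.SfmBl
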